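import Literature.MathematicalPhysics.QuantumFieldTheory.Balaban1983to89.B8SockLettersRDInterpOfLamTop

/-!
# `Balaban1983to89.B8SockLettersRDInterpOfLamTopInAk` — the sequel of `B8SockLettersRDInterpOfLamTop` IN THE SOCKET'S OWN FRAME: under [Balaban1985RegularSpaces] (1.7)–(1.9)
# `U₀ ∈ 𝔄_k({Ω_j}, α₀)` (`InAk`, the antecedent of `SockLettersRD`) with `α₀` inside [Balaban1985Averaging] Prop. 2's window, the averaged-background legs
# `Ū₀ᵐ(Γ)` UNDER THE CONSTRAINT TOWERS are unitary (Prop. 2 WITH ITS PRINTED LOCALITY, via `B7Prop1Local`'s clamped extension), so [4]'s interpolation letter `H′`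
# of the prequel satisfies conjuncts 6 (`B₀′_H := 1`), 9, 10, 11 of `SockLettersRD` at every (1.3)–(1.5)-admissible member with NO displayed unitarity hypothesis

statement-level skeleton of published theorems with citation tags; proofs where landed; nothing here is a claim about the Yang–Mills mass gap

T. Bałaban, *Spaces of regular gauge field configurations on a lattice and gauge fixing conditions*, Commun. Math. Phys. **99** (1985) 75–102
`[Balaban1985RegularSpaces]` ("B8"): (1.7)–(1.9) p. 77 (`𝔄_k({Ω_j}, α₀)`), (1.3)–(1.6) p. 77, (1.33) p. 82 («|Ū₀ʲ − 1| … on Ω_j^{(j)}» — the averaged backgrounds are controlled on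
the regions only), (1.91)–(1.92) p. 91, (1.107) p. 94.  T. Bałaban, *Averaging operations for lattice gauge theories*, Commun. Math. Phys. **98** (1985) 17–51 `[Balaban1985Averaging]`
("[3]"): Prop. 2 (52)–(54) p. 26 and the sentence after (54) «The result is local in the sense that if p = ⟨x, y, z, w⟩, then it is enough to assume (52) for p ⊂
Bᵏ(x) ∪ Bᵏ(y) ∪ Bᵏ(z) ∪ Bᵏ(w)»; p. 24 «Ū^k_c depends only on the bond variables U_b for b ⊂ Bᵏ(c₋) ∪ Bᵏ(c₊)»; (78)–(80) p. 30.  T. Bałaban, *Propagators for lattice gauge theories in a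
background field*, Commun. Math. Phys. **99** (1985) 389–434 `[Balaban1985BackgroundPropagators]` ("[4]"): (3.16)–(3.19) p. 393, Thm 3.1 p. 397.

## WHY THIS FILE (cell `pub-ymgap`, HUMAN RULING D-0062; width seat `pub-ymgap-dag-n05-w1` g3, DAG node N05 = [B8]; proof lane, count-neutral)

The prequel builds, at every lawful (1.3)–(1.5)-admissible member and every background, an `H′` with [4]'s interpolation clause (conjunct 11 of `SockLettersRD`) and support
(conjunct 9), and derives the sup bound (conjunct 6) and reality (conjunct 10) from a DISPLAYED hypothesis «the averaged backgrounds `Ū₀ˡ`, `l < n`, are unitary-valued» — which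
[3] Prop. 2 (`B7Prop2Explicit.avgIter_mem`) supplies only from the GLOBAL small-field class (52) on ALL of `ℤᵈ`.  The socket's own antecedent is the REGIONAL class (1.7)–(1.9)
`U₀ ∈ 𝔄_k({Ω_j}, α₀)` (`B8Ineq132.InAk`: plaquettes of `Ω_j` small at the rate `α₀L^{−2j}`), under which `Ū₀ˡ` need not be unitary (or even near `1`) away from `Ω_l`.  But the
prequel's hypotheses (iii)–(iv) are CHAIN-LOCAL: `H′` reads the legs `Ū₀ᵐ(Γ_{Lx_{m+1}, x_m})`, `m < j`, only along the ancestor chains of sites UNDER a constraint tower `Bʲ(z)`,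
`z ∈ Λs n j`, and such a tower lies in `Ω_j ⊆ Ω_{m+1}` (the tower law), where (1.7) holds at the rate `α₀L^{−2(m+1)}`.  [3] Prop. 2 WITH ITS PRINTED LOCALITY — kernel-available as
`B7Prop1Local` (the clamped extension `clampCfg`: a configuration clamped to a box is small-field EVERYWHERE iff it is on the box, and its averages agree with the original's on
the box tower, `B8Ineq130.agree_level`) — then makes every such leg unitary.  THIS FILE proves that and re-issues the interpolation letter in the socket's frame.

## WHAT IS PROVED (kernel, 0 sorry, 0 def)

* §1 ★ `avgIter_mem_unitaryUnits_box_of_inAk` — REGIONAL [3] Prop. 2 (membership form) from (1.7): for unitary-valued `U₀ ∈ 𝔄_k({Ω_j}, α₀)` (`InAk`), `L ≥ 2`, `C₀α₀ ≤ ⅓`,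
  `2α₀ ≤ c₂′`, a level-`(m+1)` site `w` whose fine block `B^{m+1}(w)` lies in `Ω_{m+1}` (`m + 1 ≤ k`): `Ū₀ᵐ` is unitary on every level-`m` bond of the `L`-block under `w`;
  ★ `bgT_chain_mem_unitaryUnits_of_inAk` — hence every leg `Ū₀ᵐ(Γ_{Lx_{m+1}, x_m})`, `m < j`, along the ancestor chain of a site under a level-`j` constraint tower contained in
  `Ω_j` (`j ≤ k`) is unitary.
* §2 ★★ `exists_interp_of_lamTop_inAk` — the `ZdIdx` edition of the prequel IN THE SOCKET'S FRAME: lawful member (`IdxB8Laws`), `DomainSeq`, the (1.5) face, `n ≤ k`, unitary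
  `U₀` with `InAk L i.k i.η α₀ i.Ω U₀`, `0 < α₀`, `C₀α₀ ≤ ⅓`, `2α₀ ≤ c₂′` ⊢ `∃ H'` with conjuncts 11, 9, 6 (`B₀′_H := 1`), 10 of `SockLettersRD` — NO displayed unitarity of `Ū₀`;
  ★ `exists_interp_at_binder_inAk` (p619291's literal binder prefix and the socket's quantifier prefix `∀ α₀, 0 < α₀ → α₀ ≤ cP → ∀ U₀ unitary, InAk → ∀ n, 1 ≤ n → n ≤ k`, for any
  threshold `cP` inside [3]'s window); `exists_interp_idxB8SubD_inAk` (index of record).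

## HONEST SCOPE

Bookkeeping on landed estimates: [3] Prop. 2 is `B7Prop2Explicit.avgIter_mem` (kernel-proved there), its locality is `B7Prop1Local`'s device; this file only CLAMPS under the
constraint towers.  It inhabits conjuncts 6, 9, 10, 11 of `SockLettersRD` at every (1.3)–(1.5)-admissible member in the socket's own frame (threshold `cP ≤ c₂` of [3]); it does
NOT touch conjuncts 7–8 ((1.92)'s smoothness, [4] Thm 3.1 — N06 content), `G′ ∕ C ∕ R`, or any estimate of [B8] ∕ [4] beyond [3] Prop. 2; the five (1.5)-keyed families of the N05
road remain HYPOTHESES.  Count-neutral; N05 NOT discharged; `T_η ↦ ℤᵈ`; one finite `𝕋⁴` programme at fixed `ε`, Bałaban as printed — the Yang–Mills mass gap (Clay) is NOT proved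
by any of this; R4 closes the conditional finite-`𝕋⁴` rung `BalabanLadder.UV` only; nothing continuum ∕ ℝ⁴ ∕ OS.  No `sorry`, no `def`, no `instance`, no `notation`.
Unit `pub-ymgap-dag-n05-w1` (g3), 2026-08-28.

[cite: Balaban1985RegularSpaces, (1.7)–(1.9) p.77, (1.3)–(1.6) p.77, (1.33) p.82, (1.107) p.94; Balaban1985Averaging, Prop. 2 (52)–(54) p.26, p.24, (78)–(80) p.30; Balaban1985BackgroundPropagators, (3.16)–(3.19) p.393, Thm 3.1 p.397]
-/

noncomputable section

open NormedSpace

namespace Literature.MathematicalPhysics.QuantumFieldTheory.Balaban1983to89.B8SockLettersRDInterpOfLamTopInAk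

open Literature.MathematicalPhysics.QuantumLattice (blockMap blockSites blockBase)
open B7Prop1Explicit B7Prop1Local
open B7Prop2Explicit (unitaryUnits unitaryUnits_le_U1 hol_mem_of avgIter avgIter_mem avgClosed_unitaryUnits C0 c2' pdev hol_plaqWord_self)
open B7Eq78Linearization (zdBlocking QprimeIter)
open B8Ineq130 (tlo thi agree_level axialFn_congr)
open B8Ineq132 (Under InAk)
open B8Eq119TwistedAxial (bgT)
open B8Eq1117Concrete (XSpace)
open B8LeafModelZd (ZdIdx)
open B8ConstraintBonds (DomainSeq Lam)
open B8IdxB8LawsB (IdxB8LawsB)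
open B8CubeMemberZd (inBox_tower_iff_under)
open B8Eq191FlatLettersCubeMember (under_iff_blockMap_eq under_smul_self)
open B8IdxB8LamTopTowerDisjoint (towers_disjoint_of_lamTop_blockMap)
open B8SockLettersRDInterpOfLamTop (exists_interp_of_towersDisjoint)
open Node00 (Stage3Params IdxB8Laws IdxB8SubD)

-- `Site` alone could resolve to the torus sites of `Setup.lean`; re-export the `ℤ^d` sites of `B7Prop1Explicit`.
export B7Prop1Explicit (Site)

variable {d : ℕ}

/-! ## §0 Plumbing -/

/-- The plaquette set of a box is finite, so a strict pointwise bound from (1.7) on a box of sites of `Ω_j` is a strict bound of `pdevOn` (the box edition of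
`B8Ineq132.pdevOn_lt_of_inAk`; private plumbing — the statement of `B8Ineq166Univ.pdevOn_box_lt_of_inAk`). [cite: Balaban1985RegularSpaces, (1.7) p.77] -/
private theorem pdevOn_box_lt_of_inAk' {𝔸 : Type*} [NormedRing 𝔸] [NormedAlgebra ℂ 𝔸] {L : ℕ} (hL : 1 ≤ L) {k : ℕ} {η α : ℝ} (hα : 0 < α)
    {Ω : ℕ → Set (Site d)} {U : Site d → Fin d → 𝔸ˣ} (hA : InAk L k η α Ω U) {j : ℕ} (hj : j ≤ k) {lo hi : Site d}
    (hbox : ∀ x, InBox lo hi x → x ∈ Ω j) : pdevOn lo hi U < α * (((L : ℝ) ^ j)⁻¹) ^ 2 := by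
  have hL0 : 0 < L := hL
  refine B8Ineq132.pdevOn_lt_of_forall (by positivity) fun x μ ν hx _ => ?_
  rcases eq_or_ne μ ν with rfl | hμν
  · rw [hol_plaqWord_self, Units.val_one, sub_self, norm_zero]; positivity
  · exact (hA j hj).1 x μ ν hμν (Or.inl (hbox x hx))

/-- `blockBase L w = L•w` (`= tlo L w 1`; private plumbing). [cite: Balaban1985Averaging, (2) p.17] -/
private theorem blockBase_eq_tlo_one (L : ℕ) (w : Site d) : blockBase L w = tlo L w 1 := by
  rw [B8Ineq130.tlo_succ, B8Ineq130.tlo_zero]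
  funext i; simp [blockBase, Pi.smul_apply]

/-! ## §1 Regional Proposition 2 under (1.7): unitary averaged backgrounds under a block inside `Ω_{m+1}` -/

section Regional

variable {𝔸 : Type*} [CStarAlgebra 𝔸] [Nontrivial 𝔸]

/-- ★ **REGIONAL [3] PROP. 2 FROM (1.7), CLAMPED FORM**: let `U₀` be unitary-valued with `U₀ ∈ 𝔄_k({Ω_j}, α₀)` (`InAk`), `L ≥ 2`, `0 < α₀`, `C₀α₀ ≤ ⅓`, `2α₀ ≤ c₂′`, and let `w`
be a level-`(m+1)` label (`m + 1 ≤ k`) whose fine block `B^{m+1}(w) = [tlo L w (m+1), thi L w (m+1)]` lies in `Ω_{m+1}`.  Then there is a unitary-valued configuration `V′` on ALL of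
`ℤᵈ` (the clamped extension `clampCfg (B^{m+1}(w)) U₀` of `B7Prop1Local`) ALL of whose averages `V̄′ˡ`, `l ≤ m + 1`, are unitary-valued, and whose `m`-fold average AGREES with
`Ū₀ᵐ` on the `L`-block `[tlo L w 1, thi L w 1]` under `w`.  PROOF: `V′` satisfies (52) `pdev V′ < α₀L^{−2(m+1)}` everywhere (`pdev_clampCfg_le` + (1.7) on the box), so the global
Prop. 2 (`avgIter_mem`) applies; locality is `B8Ineq130.agree_level`. [cite: Balaban1985Averaging, Prop. 2 (52)–(54) p.26 + the sentence after (54), p.24; Balaban1985RegularSpaces, (1.7) p.77, (1.33) p.82] -/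
theorem exists_clamp_avgIter_unitary_of_inAk {L : ℕ} (hL : 2 ≤ L) {k : ℕ} {η α₀ : ℝ} {Ω : ℕ → Set (Site d)}
    {U₀ : Site d → Fin d → 𝔸ˣ} (hU : ∀ x κ, U₀ x κ ∈ unitaryUnits 𝔸) (hA : InAk L k η α₀ Ω U₀)
    (hα : 0 < α₀) (hα3 : C0 d * α₀ ≤ 1 / 3) (hα2 : 2 * α₀ ≤ c2' d L)
    {m : ℕ} (hmk : m + 1 ≤ k) (w : Site d) (hbox : ∀ x, InBox (tlo L w (m + 1)) (thi L w (m + 1)) x → x ∈ Ω (m + 1)) :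
    ∃ V' : Site d → Fin d → 𝔸ˣ, (∀ l, l ≤ m + 1 → ∀ x κ, avgIter L V' l x κ ∈ unitaryUnits 𝔸) ∧
      AgreeOn (tlo L w 1) (thi L w 1) (avgIter L U₀ m) (avgIter L V' m) := by
  have hL1 : 1 ≤ L := le_trans (by norm_num) hL
  refine ⟨clampCfg (tlo L w (m + 1)) (thi L w (m + 1)) U₀, ?_, ?_⟩
  · have hV'u : ∀ x κ, clampCfg (tlo L w (m + 1)) (thi L w (m + 1)) U₀ x κ ∈ unitaryUnits 𝔸 := clampCfg_mem hU
    have hlohi : ∀ i, tlo L w (m + 1) i ≤ thi L w (m + 1) i := fun i => by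
      have h := (inBox_tower_iff_under L (m + 1) w _).2 (under_smul_self hL1 (m + 1) w) i
      exact h.1.trans h.2
    have hUU : ∀ x κ, U₀ x κ ∈ U1 𝔸 := fun x κ => unitaryUnits_le_U1 (hU x κ)
    have h52 : pdev (clampCfg (tlo L w (m + 1)) (thi L w (m + 1)) U₀) < α₀ * (((L : ℝ) ^ (m + 1))⁻¹) ^ 2 :=
      (pdev_clampCfg_le hlohi hUU).trans_lt (pdevOn_box_lt_of_inAk' hL1 hα hA hmk hbox)
    exact avgIter_mem L hL (avgClosed_unitaryUnits (d := d) L) (m + 1) _ hV'u hα hα3 hα2 h52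
  · have hag : AgreeOn (tlo L w (1 + m)) (thi L w (1 + m)) U₀ (clampCfg (tlo L w (m + 1)) (thi L w (m + 1)) U₀) := by
      rw [Nat.add_comm]; exact (clampCfg_agree U₀).symm
    exact agree_level hL1 m 1 hag

/-- ★ **REGIONAL [3] PROP. 2, MEMBERSHIP FORM**: under the hypotheses of `exists_clamp_avgIter_unitary_of_inAk`, `Ū₀ᵐ` is UNITARY on every level-`m` bond `⟨x, x + e_κ⟩` of the
`L`-block `[tlo L w 1, thi L w 1]` under `w` (print (1.33)'s region: the averaged backgrounds are controlled on `Ω_j^{(j)}` only).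
[cite: Balaban1985Averaging, Prop. 2 (52)–(54) p.26 + the sentence after (54); Balaban1985RegularSpaces, (1.7) p.77, (1.33) p.82] -/
theorem avgIter_mem_unitaryUnits_box_of_inAk {L : ℕ} (hL : 2 ≤ L) {k : ℕ} {η α₀ : ℝ} {Ω : ℕ → Set (Site d)}
    {U₀ : Site d → Fin d → 𝔸ˣ} (hU : ∀ x κ, U₀ x κ ∈ unitaryUnits 𝔸) (hA : InAk L k η α₀ Ω U₀)
    (hα : 0 < α₀) (hα3 : C0 d * α₀ ≤ 1 / 3) (hα2 : 2 * α₀ ≤ c2' d L)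
    {m : ℕ} (hmk : m + 1 ≤ k) (w : Site d) (hbox : ∀ x, InBox (tlo L w (m + 1)) (thi L w (m + 1)) x → x ∈ Ω (m + 1)) :
    ∀ (x : Site d) (κ : Fin d), InBox (tlo L w 1) (thi L w 1) x → InBox (tlo L w 1) (thi L w 1) (x + e κ) →
      avgIter L U₀ m x κ ∈ unitaryUnits 𝔸 := by
  obtain ⟨V', hV', hag⟩ := exists_clamp_avgIter_unitary_of_inAk hL hU hA hα hα3 hα2 hmk w hbox
  intro x κ hx hxe
  rw [hag x κ hx hxe]
  exact hV' m (Nat.le_succ m) x κ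

/-- ★ **THE LEGS ALONG THE ANCESTOR CHAINS UNDER THE CONSTRAINT TOWERS ARE UNITARY** under (1.7): with `U₀`, `α₀` as above, a tower `Λ` of a truncation `n ≤ k` obeying the tower
law «`Bʲ(z) ⊂ Ω_j` for `z ∈ Λ_j`, `j ≤ n`» (block-label spelling) over an antitone `{Ω_j}`: for every site `x` under a constraint point `(j, x_j)` and every `m < j`, the leg
`Ū₀ᵐ(Γ_{Lx_{m+1}, x_m}) = bgT L U₀ m x_{m+1} x_m` (`x_l = blockMap (Lˡ) x`) is unitary — the chain-local hypothesis (iv) of `exists_interp_of_towersDisjoint` (and (iii), as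
unitaries have `|u|, |u⁻¹| ≤ 1`).  The fine block `B^{m+1}(x_{m+1})` lies in `Bʲ(x_j) ⊂ Ω_j ⊆ Ω_{m+1}`, so §1 applies; the leg is the tree-word transporter of `Ū₀ᵐ` inside the
`L`-block under `x_{m+1}`, equal to that of the clamped configuration (`B8Ineq130.axialFn_congr`). [cite: Balaban1985Averaging, Prop. 2 p.26, (52)–(53) p.27, (78)–(80) p.30; Balaban1985RegularSpaces, (1.7) p.77, (1.5)–(1.6) p.77] -/
theorem bgT_chain_mem_unitaryUnits_of_inAk {L : ℕ} (hL : 2 ≤ L) {k : ℕ} {η α₀ : ℝ} {Ω : ℕ → Set (Site d)} (hanti : ∀ a b, a ≤ b → Ω b ⊆ Ω a)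
    {U₀ : Site d → Fin d → 𝔸ˣ} (hU : ∀ x κ, U₀ x κ ∈ unitaryUnits 𝔸) (hA : InAk L k η α₀ Ω U₀)
    (hα : 0 < α₀) (hα3 : C0 d * α₀ ≤ 1 / 3) (hα2 : 2 * α₀ ≤ c2' d L)
    {n : ℕ} (hn : n ≤ k) {Λ : ℕ → Set (Site d)} (htower : ∀ j, j ≤ n → ∀ z ∈ Λ j, ∀ x : Site d, blockMap (L ^ j) x = z → x ∈ Ω j) :
    ∀ j, j ≤ n → ∀ x : Site d, blockMap (L ^ j) x ∈ Λ j → ∀ m, m < j →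
      bgT L U₀ m (blockMap (L ^ (m + 1)) x) (blockMap (L ^ m) x) ∈ unitaryUnits 𝔸 := by
  have hL1 : 1 ≤ L := le_trans (by norm_num) hL
  intro j hj x hmem m hm
  set w : Site d := blockMap (L ^ (m + 1)) x with hw
  -- the fine block under `w` lies in `Bʲ(x_j) ⊂ Ω_j ⊆ Ω_{m+1}`
  have hbox : ∀ x'', InBox (tlo L w (m + 1)) (thi L w (m + 1)) x'' → x'' ∈ Ω (m + 1) := by
    intro x'' hx''
    have h1 : blockMap (L ^ (m + 1)) x'' = w := (under_iff_blockMap_eq hL1 (m + 1) w x'').1 ((inBox_tower_iff_under L (m + 1) w x'').1 hx'')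
    have h2 : blockMap (L ^ j) x'' = blockMap (L ^ j) x := by
      obtain ⟨t, rfl⟩ : ∃ t, j = m + 1 + t := ⟨j - (m + 1), by omega⟩
      rw [pow_add, ← B7BlockGeometry.blockMap_blockMap, ← B7BlockGeometry.blockMap_blockMap, h1]
    exact hanti _ _ (by omega) (htower j hj _ hmem x'' h2)
  obtain ⟨V', hV', hag⟩ := exists_clamp_avgIter_unitary_of_inAk hL hU hA hα hα3 hα2 (by omega : m + 1 ≤ k) w hbox
  -- the leg is the tree-word transporter of `Ū₀ᵐ` inside the `L`-block under `w`
  have hx' : InBox (tlo L w 1) (thi L w 1) (blockMap (L ^ m) x) := by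
    refine (inBox_tower_iff_under L 1 w _).2 ((under_iff_blockMap_eq hL1 1 w _).2 ?_)
    rw [pow_one, hw, pow_succ, ← B7BlockGeometry.blockMap_blockMap]
  have hy : InBox (tlo L w 1) (thi L w 1) (blockBase L w) := by
    have h := (inBox_tower_iff_under L 1 w _).2 (under_smul_self hL1 1 w)
    rw [pow_one] at h
    rw [blockBase_eq_tlo_one]; exact h
  show axialFn (avgIter L U₀ m) (blockBase L w) (blockMap (L ^ m) x) ∈ unitaryUnits 𝔸
  rw [axialFn_congr hag _ _ hy hx']
  unfold axialFn
  exact hol_mem_of (hV' m (Nat.le_succ m)) _ _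

end Regional


/-! ## §2 The interpolation letter in the socket's own frame: (1.7) instead of a displayed unitarity of `Ū₀` -/

section InAkFrame

variable {𝔸 : Type*} [CStarAlgebra 𝔸] [Nontrivial 𝔸]

/-- ★★ **[4]'s INTERPOLATION LETTER AT EVERY (1.3)–(1.5)-ADMISSIBLE LAW MEMBER, IN THE SOCKET'S FRAME**: for `L ≥ 2`, `i : ZdIdx d L` with the located laws `IdxB8Laws L i`,
(1.3)–(1.4) `DomainSeq L i.Ω` and the (1.5) face, a truncation `n ≤ k`, a UNITARY background `U₀ ∈ 𝔄_k({Ω_j}, α₀)` (`InAk L i.k i.η α₀ i.Ω U₀`) with `0 < α₀`, `C₀α₀ ≤ ⅓`,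
`2α₀ ≤ c₂′` ([3] Prop. 2's window): there is a `ℂ`-linear `H′` with conjunct 11 of `SockLettersRD` VERBATIM at `(n, i.Λs n)`, conjunct 9, conjunct 6 with `B₀′_H := 1` and
conjunct 10 — NO displayed unitarity of the averaged backgrounds (it is DERIVED under the constraint towers by §1).  Positive twin of
`B8SockLettersRDIdxB8LawsBVacuity.interp_clause_false`, in the frame the binder `SLet` of p619291 quantifies over.
[cite: Balaban1985RegularSpaces, (1.3)–(1.9) p.77, (1.33) p.82, (1.91)–(1.92) p.91, (1.107) p.94; Balaban1985BackgroundPropagators, (3.16)–(3.19) p.393, Thm 3.1 p.397; Balaban1985Averaging, Prop. 2 p.26] -/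
theorem exists_interp_of_lamTop_inAk {L : ℕ} (hL : 2 ≤ L) (i : ZdIdx d L) (hlaws : IdxB8Laws L i) (hΩ : DomainSeq L i.Ω)
    (hΛ : ∀ j, j < i.k → ∀ z ∈ i.Λs i.k j, ((L : ℤ) ^ j) • z ∈ Lam L i.Ω j) {n : ℕ} (hn : n ≤ i.k)
    {U₀ : Site d → Fin d → 𝔸ˣ} (hU : ∀ x κ, U₀ x κ ∈ unitaryUnits 𝔸) {α₀ : ℝ} (hA : InAk L i.k i.η α₀ i.Ω U₀)
    (hα : 0 < α₀) (hα3 : C0 d * α₀ ≤ 1 / 3) (hα2 : 2 * α₀ ≤ c2' d L) :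
    ∃ H' : XSpace d n 𝔸 →ₗ[ℂ] (Site d → 𝔸),
      (∀ (Y : XSpace d n 𝔸) (j : ℕ) (hj : j ≤ n) (y : Site d), y ∈ i.Λs n j →
          QprimeIter (zdBlocking d L) (bgT L U₀) j (H' Y) y = Y (⟨j, Nat.lt_succ_of_le hj⟩, y)) ∧
      (∀ (X : XSpace d n 𝔸) (x : Site d), x ∉ i.Ω 0 → H' X x = 0) ∧
      (∀ (X : XSpace d n 𝔸) (x : Site d), ‖H' X x‖ ≤ 1 * ‖X‖) ∧
      (∀ X Y : XSpace d n 𝔸, (∀ p, Y p = -star (X p)) → ∀ x, H' Y x = -star (H' X x)) := by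
  have hL1 : 1 ≤ L := le_trans (by norm_num) hL
  obtain ⟨H', hint, hsupp, hnorm, hreal⟩ := exists_interp_of_towersDisjoint (𝔸 := 𝔸) hL1 (bgT L U₀) n (i.Λs n)
    (towers_disjoint_of_lamTop_blockMap hL1 i hlaws hΩ hΛ n hn)
  -- the tower law of the truncation `n`, block-label spelling
  have htower : ∀ j, j ≤ n → ∀ z ∈ i.Λs n j, ∀ x : Site d, blockMap (L ^ j) x = z → x ∈ i.Ω j :=
    fun j hj z hz x hx => hlaws.tower_all n hn j hj z hz x ((inBox_tower_iff_under L j z x).2 ((under_iff_blockMap_eq hL1 j z x).2 hx))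
  have hanti : ∀ a b, a ≤ b → i.Ω b ⊆ i.Ω a := fun a b hab => antitone_nat_of_succ_le i.hΩ hab
  have hlegs := bgT_chain_mem_unitaryUnits_of_inAk hL hanti hU hA hα hα3 hα2 hn htower
  refine ⟨H', hint, fun X x hx => hsupp X x fun j hj hmem => hx ?_, fun X x => ?_, ?_⟩
  · exact hanti 0 j (Nat.zero_le j) (htower j hj _ hmem x rfl)
  · rw [one_mul]
    exact hnorm (fun j hj x' hmem m hm => unitaryUnits_le_U1 (hlegs j hj x' hmem m hm)) X x
  · exact hreal hlegs

/-- ★ **AT THE LITERAL BINDER PREFIX OF THE P₂D SLOT AND THE SOCKET'S QUANTIFIER PREFIX** (p619291's `SLet`: `i.Ω 0 = univ → IdxB8LawsB L i → DomainSeq L i.Ω → (1.5) →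
SockLettersRD L … cP i.η i.k i.Ω i.Λs`, and inside `SockLettersRD`: `∀ α₀, 0 < α₀ → α₀ ≤ cP → ∀ U₀ unitary, InAk … → ∀ n, 1 ≤ n → n ≤ k → ∃ (… H′), …`): for any threshold `cP`
inside [3] Prop. 2's window (`C₀cP ≤ ⅓`, `2cP ≤ c₂′`), the `H′`-part of the letters — conjuncts 6 (`B₀′_H := 1`), 9, 10, 11 — is INHABITED at every member, every admissible
background, every truncation. [cite: Balaban1985RegularSpaces, (1.3)–(1.9) p.77, (1.91)–(1.92) p.91, (1.107) p.94; Balaban1985BackgroundPropagators, Thm 3.1 p.397; Balaban1985Averaging, Prop. 2 p.26] -/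
theorem exists_interp_at_binder_inAk {L : ℕ} (hL : 2 ≤ L) {cP : ℝ} (hcP3 : C0 d * cP ≤ 1 / 3) (hcP2 : 2 * cP ≤ c2' d L)
    (i : ZdIdx d L) (_h0 : i.Ω 0 = Set.univ) (hlaws : IdxB8LawsB L i) (hΩ : DomainSeq L i.Ω)
    (hΛ : ∀ l, l < i.k → ∀ z ∈ i.Λs i.k l, ((L : ℤ) ^ l) • z ∈ Lam L i.Ω l) :
    ∀ α₀ : ℝ, 0 < α₀ → α₀ ≤ cP → ∀ U₀ : Site d → Fin d → 𝔸ˣ, (∀ x κ, U₀ x κ ∈ unitaryUnits 𝔸) → InAk L i.k i.η α₀ i.Ω U₀ →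
      ∀ n : ℕ, 1 ≤ n → n ≤ i.k →
        ∃ H' : XSpace d n 𝔸 →ₗ[ℂ] (Site d → 𝔸),
          (∀ (Y : XSpace d n 𝔸) (j : ℕ) (hj : j ≤ n) (y : Site d), y ∈ i.Λs n j →
              QprimeIter (zdBlocking d L) (bgT L U₀) j (H' Y) y = Y (⟨j, Nat.lt_succ_of_le hj⟩, y)) ∧
          (∀ (X : XSpace d n 𝔸) (x : Site d), x ∉ i.Ω 0 → H' X x = 0) ∧
          (∀ (X : XSpace d n 𝔸) (x : Site d), ‖H' X x‖ ≤ 1 * ‖X‖) ∧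
          (∀ X Y : XSpace d n 𝔸, (∀ p, Y p = -star (X p)) → ∀ x, H' Y x = -star (H' X x)) := by
  intro α₀ hα hαc U₀ hU hA n _ hn
  have hC : 0 ≤ C0 d := (B7Prop2Explicit.C0_pos d).le
  exact exists_interp_of_lamTop_inAk hL i hlaws.toIdxB8Laws hΩ hΛ hn hU hA hα
    ((mul_le_mul_of_nonneg_left hαc hC).trans hcP3) (by linarith)

end InAkFrame

/-! ## §3 On the index of record `Node00.IdxB8SubD θ` -/

section Record

/-- **ON THE (1.5)-OBEYING SUB-INDEX OF RECORD, IN THE SOCKET'S FRAME**: at every `j : IdxB8SubD θ` (`θ : Node00.Stage3Params`, so `L ≥ 3`), every truncation `n ≤ k` and every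
unitary `U₀ ∈ 𝔄_k({Ω_j}, α₀)` over `θ.𝔸` with `α₀` in [3] Prop. 2's window: [4]'s interpolation letter with conjuncts 11, 9, 6 (`B₀′_H := 1`), 10 of `SockLettersRD`.
[cite: Balaban1985RegularSpaces, (1.3)–(1.9) p.77, (1.107) p.94; Balaban1985BackgroundPropagators, Thm 3.1 p.397; Balaban1985Averaging, Prop. 2 p.26] -/
theorem exists_interp_idxB8SubD_inAk {θ : Stage3Params} (j : IdxB8SubD θ) {n : ℕ} (hn : n ≤ j.1.1.1.1.k)
    {U₀ : Site θ.D → Fin θ.D → θ.𝔸ˣ} (hU : ∀ x κ, U₀ x κ ∈ unitaryUnits θ.𝔸) {α₀ : ℝ} (hA : InAk θ.L j.1.1.1.1.k j.1.1.1.1.η α₀ j.1.1.1.1.Ω U₀)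
    (hα : 0 < α₀) (hα3 : C0 θ.D * α₀ ≤ 1 / 3) (hα2 : 2 * α₀ ≤ c2' θ.D θ.L) :
    ∃ H' : XSpace θ.D n θ.𝔸 →ₗ[ℂ] (Site θ.D → θ.𝔸),
      (∀ (Y : XSpace θ.D n θ.𝔸) (l : ℕ) (hl : l ≤ n) (y : Site θ.D), y ∈ j.1.1.1.1.Λs n l →
          QprimeIter (zdBlocking θ.D θ.L) (bgT θ.L U₀) l (H' Y) y = Y (⟨l, Nat.lt_succ_of_le hl⟩, y)) ∧
      (∀ (X : XSpace θ.D n θ.𝔸) (x : Site θ.D), x ∉ j.1.1.1.1.Ω 0 → H' X x = 0) ∧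
      (∀ (X : XSpace θ.D n θ.𝔸) (x : Site θ.D), ‖H' X x‖ ≤ 1 * ‖X‖) ∧
      (∀ X Y : XSpace θ.D n θ.𝔸, (∀ p, Y p = -star (X p)) → ∀ x, H' Y x = -star (H' X x)) :=
  exists_interp_of_lamTop_inAk (le_trans (by norm_num) θ.two_le_L) j.1.1.1.1 j.laws j.domainSeq j.lamTop hn hU hA hα hα3 hα2

end Record

end Literature.MathematicalPhysics.QuantumFieldTheory.Balaban1983to89.B8SockLettersRDInterpOfLamTopInAk

end
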